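import Summits.Ventures.PercRepro.S2RowFifteenOpenOne
import Summits.Ventures.PercRepro.S2FifteenSix

/-!
# PercRepro — S2: THEOREM C₅ AT `16` MODULO THE TRIANGLE COUNT OF A SPREAD CORE OF NULLITY `6` (p7, gen 12; sub-claim S2)

With `(15, 6)` a tree theorem modulo `hsix` (S2FifteenSix), the «16» assembly needs only that one structural statement:
**`c025_five_large_sharp16_of_triangles`** — C-025 at level `5` for every `p ≥ 16` from «an `e`-free core of rank `15` on `21` points
with no set of nullity `5` on `≤ 10` points and none of nullity `4` on `≤ 9` points has at most `8` triangles» (S2 v36 §R3⁗(u) proves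
`≤ 6` on paper). Nothing here asserts a window move. Axioms: standard.
-/

open scoped Matroid

namespace PercRepro

namespace ThmN

variable {α : Type}

/-- **THEOREM C₅ AT `16` MODULO THE TRIANGLE COUNT** of a spread core of nullity `6`. -/
theorem c025_five_large_sharp16_of_triangles
    (hsix : ∀ (M : Matroid α) [M.Finite], M.eRank = ((15 : ℕ) : ℕ∞) → M.E.ncard = 15 + 6 →
      (∀ e ∈ M.E, ∃ A ⊆ M.E \ {e}, e ∉ M.closure A ∧ e ∉ M.closure ((M.E \ {e}) \ A)) →
      ¬ (∃ W ⊆ M.E, W.ncard ≤ 10 ∧ W.encard = M.eRk W + 5) → ¬ (∃ W ⊆ M.E, W.ncard ≤ 9 ∧ W.encard = M.eRk W + 4) →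
      {C : Set α | M.IsCircuit C ∧ C.ncard = 3}.ncard ≤ 8)
    (M : Matroid α) [M.Finite] (p : ℕ) (hp : 16 ≤ p) : RLS M p 5 :=
  c025_five_large_sharp16_of_one_cell
    (fun M _ hR hn hfree => c025_core_five_fifteen_six_of_triangles hsix M hR hn hfree) M p hp

end ThmN

end PercRepro
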